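import Literature.Computability.QuantumAlgorithms.ApexCliqueCount
/-!
# Apex cliques encode the hard-core partition function (DEQ-A07F, Theorem W1, all `(m; a, b, c)`)

HONEST FRAMING: instance-level adjudication of specific advantage claims; no claim about
BQP vs BPP or the summit.

Context (cell pub-qadeq, claim A-07 = Berry et al., arXiv:2209.13581v3 = PRX Quantum 5, 010319
(2024), §4.1 family `K(m,k)`; refined open question OPEN-1, model (W) = adversarial edge deletions).
DEQ-A07F.md (unit pub-qadeq-deq-1), Theorem W1, builds for every graph `H` on `k` vertices and every
`m = a + b + c + 1 ≥ 3` a deletion set `D = D(H; m, a, b)` inside `K(m,k)` such that the Euler-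
characteristic target of the estimator EULER-MC of DEQ-A07/A07E,
`e(G) = (-1)^k Σ_{S clique} (-1)^{|S|}`, equals the bivariate independence polynomial
`P_H(a,b) = Σ_{I independent in H} a^{k-|I|} b^{|I|} = a^k Z_H(b/a)` (hard-core partition function),
whence the #P-hardness / no-FPRAS-unless-NP=RP conclusions of Theorem W2 there
[Dyer–Greenhill 2000; Greenhill 2000; Sly 2010 Thm 2; Galanis–Štefankovič–Vigoda 2016 Thm 1]
(cited there, not here; Mathlib has no #P / FPRAS notions and none is formalised).

This file proves that identity, sorry-free, for ALL parameters `(a, b, c)`, as a corollary of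
`Literature.Computability.QuantumAlgorithms.ApexCliqueCount.signed_clique_count` (DEQ-A07 Prop. C):

* vertices `Fin k × Fin (a+b+c+1)`; in part `v` the position `0` is the apex, positions `1 … a` are
  *free copies*, positions `a+1 … a+b` are *H-copies*, positions `a+b+1 … a+b+c` are *dead copies*;
  `encAdj` joins two vertices of different parts unless (i) they are two H-copies over an edge of `H`,
  or (ii) one is a dead copy of part `v` and the other a non-apex vertex of part `σ v`, for a fixed-
  point-free map `σ` (DEQ-A07F uses `σ v = v + 1 mod k`; any fixed-point-free `σ` works);
* `full_cliques_eq_image`: the cliques meeting every part off the apex are exactly the transversals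
  `funClique f` of the position choices `f : Fin k → Fin (a+b)` (no dead copy can occur) whose set of
  H-positions is independent in `H` (`goodFuns`), and `card_goodFuns` counts them fibrewise over that
  independent set: `Σ_I a^{k-|I|} b^{|I|}`;
* `signed_clique_count_hardCore`: `Σ_{S clique} (-1)^|S| = (-1)^k · Σ_{I ∈ Ind(H)} a^{k-|I|} b^{|I|}`,
  with the corollaries `a = 1` (independence polynomial `Σ_I b^{|I|}`, encodings `(1,b,c)` such as
  `(m;a,b,c) = (16;1,5,9)` of Theorem W2(ii)) and `a = b = 1` (number of independent sets; `m = 3`).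

Everything here is `[folklore]`-level finite combinatorics; no named fact, no axiom.
-/
namespace Summit.QuantumAdvantage.Dequantization.ApexHardCore
open Finset Literature.Computability.QuantumAlgorithms.ApexCliqueCount
variable {k : ℕ}
/-! ## The encoding graph -/
/-- The hard-core encoding on `Fin k × Fin (a+b+c+1)`: position `0` apex, `1..a` free, `a+1..a+b`
H-copies, `a+b+1..a+b+c` dead (a dead copy of part `v` misses every non-apex vertex of part `σ v`). -/
def encAdj (a b c : ℕ) (hadj : Fin k → Fin k → Bool) (σ : Fin k → Fin k)
    (u v : Vx k (a + b + c)) : Bool :=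
  if u.1 = v.1 then false
  else if (a + b < u.2.val ∧ v.1 = σ u.1 ∧ v.2 ≠ 0) ∨ (a + b < v.2.val ∧ u.1 = σ v.1 ∧ u.2 ≠ 0)
    then false
  else if (a < u.2.val ∧ u.2.val ≤ a + b) ∧ (a < v.2.val ∧ v.2.val ≤ a + b) then !(hadj u.1 v.1)
  else true
/-- Independent sets of `H` (given as a Boolean adjacency; only off-diagonal entries are read). -/
def indepSets (hadj : Fin k → Fin k → Bool) : Finset (Finset (Fin k)) :=
  univ.filter (fun I => ∀ u ∈ I, ∀ v ∈ I, u ≠ v → hadj u v = false)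
/-- A choice of non-apex, non-dead position in every part (`x ↦ x+1`): values `< a` are free copies,
values `≥ a` are H-copies. -/
def liftPos (a b c : ℕ) (x : Fin (a + b)) : Fin (a + b + c + 1) :=
  ⟨x.val + 1, by have := x.isLt; omega⟩
/-- The transversal attached to a position choice `f`. -/
def funClique (a b c : ℕ) (f : Fin k → Fin (a + b)) : Finset (Vx k (a + b + c)) :=
  univ.image (fun v : Fin k => (v, liftPos a b c (f v)))
/-- The *good* position choices: those whose H-positions form an independent set of `H`. -/
def goodFuns (a b : ℕ) (hadj : Fin k → Fin k → Bool) : Finset (Fin k → Fin (a + b)) :=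
  univ.filter (fun f => ∀ u v : Fin k, u ≠ v → a ≤ (f u).val → a ≤ (f v).val → hadj u v = false)
/-- `[folklore]` membership in `goodFuns`. -/
lemma mem_goodFuns (a b : ℕ) (hadj : Fin k → Fin k → Bool) (f : Fin k → Fin (a + b)) :
    f ∈ goodFuns a b hadj ↔
      ∀ u v : Fin k, u ≠ v → a ≤ (f u).val → a ≤ (f v).val → hadj u v = false := by
  unfold goodFuns
  rw [Finset.mem_filter]
  simp only [Finset.mem_univ, true_and]
/-- The set of H-positions of a position choice. -/
def hset (a b : ℕ) (f : Fin k → Fin (a + b)) : Finset (Fin k) :=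
  univ.filter (fun v => a ≤ (f v).val)
/-! ## Elementary properties of the encoding -/
/-- `[folklore]` unfolding of `encAdj`. -/
lemma encAdj_true_iff (a b c : ℕ) (hadj : Fin k → Fin k → Bool) (σ : Fin k → Fin k)
    (u v : Vx k (a + b + c)) :
    encAdj a b c hadj σ u v = true ↔
      u.1 ≠ v.1 ∧
      ¬ ((a + b < u.2.val ∧ v.1 = σ u.1 ∧ v.2 ≠ 0) ∨ (a + b < v.2.val ∧ u.1 = σ v.1 ∧ u.2 ≠ 0)) ∧
      ((a < u.2.val ∧ u.2.val ≤ a + b) → (a < v.2.val ∧ v.2.val ≤ a + b) → hadj u.1 v.1 = false) := by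
  unfold encAdj
  split_ifs with h1 h2 h3
  · constructor
    · intro h; cases h
    · rintro ⟨hne, -⟩; exact absurd h1 hne
  · constructor
    · intro h; cases h
    · rintro ⟨-, hnd, -⟩; exact absurd h2 hnd
  · constructor
    · intro h; refine ⟨h1, h2, fun _ _ => ?_⟩; simpa using h
    · rintro ⟨-, -, himp⟩; have := himp h3.1 h3.2; simp [this]
  · constructor
    · intro _; exact ⟨h1, h2, fun hu hv => (h3 ⟨hu, hv⟩).elim⟩
    · intro _; rfl
/-- `[folklore]` the encoding adjacency is symmetric when `H` is. -/
lemma encAdj_symm {a b c : ℕ} {hadj : Fin k → Fin k → Bool} (hsymm : ∀ p q, hadj p q = hadj q p)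
    {σ : Fin k → Fin k} (u v : Vx k (a + b + c)) :
    encAdj a b c hadj σ u v = encAdj a b c hadj σ v u := by
  have key : ∀ u v : Vx k (a + b + c),
      encAdj a b c hadj σ u v = true → encAdj a b c hadj σ v u = true := by
    intro u v h
    rw [encAdj_true_iff] at h ⊢
    refine ⟨fun e => h.1 e.symm, fun hd => h.2.1 hd.symm, fun hv hu => ?_⟩
    rw [hsymm]; exact h.2.2 hu hv
  rcases Bool.eq_false_or_eq_true (encAdj a b c hadj σ u v) with h | h <;>
    rcases Bool.eq_false_or_eq_true (encAdj a b c hadj σ v u) with h' | h'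
  · rw [h, h']
  · rw [key u v h] at h'; cases h'
  · rw [key v u h'] at h; cases h
  · rw [h, h']
/-- `[folklore]` no edges inside a part. -/
lemma encAdj_nopart {a b c : ℕ} {hadj : Fin k → Fin k → Bool} {σ : Fin k → Fin k}
    (p : Fin k) (i j : Fin (a + b + c + 1)) : encAdj a b c hadj σ (p, i) (p, j) = false := by
  simp [encAdj]
/-- `[folklore]` every `(p,0)` is an apex (adjacent to all vertices of the other parts). -/
lemma encAdj_apex {a b c : ℕ} {hadj : Fin k → Fin k → Bool} {σ : Fin k → Fin k}
    (p q : Fin k) (j : Fin (a + b + c + 1)) (hpq : p ≠ q) :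
    encAdj a b c hadj σ (p, 0) (q, j) = true := by
  rw [encAdj_true_iff]
  refine ⟨hpq, ?_, ?_⟩
  · rintro (⟨h, -, -⟩ | ⟨-, -, h⟩)
    · simp at h
    · exact h rfl
  · rintro ⟨h, -⟩ -
    simp at h
/-- `[folklore]` membership in the transversal attached to `f`. -/
lemma mem_funClique (a b c : ℕ) (f : Fin k → Fin (a + b)) (w : Vx k (a + b + c)) :
    w ∈ funClique a b c f ↔ w.2 = liftPos a b c (f w.1) := by
  unfold funClique
  constructor
  · intro hw
    obtain ⟨v, _, rfl⟩ := Finset.mem_image.mp hw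
    rfl
  · intro hw
    refine Finset.mem_image.mpr ⟨w.1, Finset.mem_univ _, ?_⟩
    obtain ⟨v, i⟩ := w
    simp only at hw; rw [hw]
/-- `[folklore]` different position choices give different transversals. -/
lemma funClique_injective (a b c : ℕ) : Function.Injective (funClique (k := k) a b c) := by
  intro f g h
  funext v
  have h1 : ((v, liftPos a b c (f v)) : Vx k (a + b + c)) ∈ funClique a b c g := by
    rw [← h, mem_funClique]
  rw [mem_funClique] at h1
  simp only at h1
  have h2 := congrArg Fin.val h1
  simp only [liftPos] at h2
  exact Fin.ext (by omega)
/-- `[folklore]` the transversal of a good position choice is a clique meeting every part off the apex. -/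
lemma funClique_mem {a b c : ℕ} {hadj : Fin k → Fin k → Bool} (σ : Fin k → Fin k)
    {f : Fin k → Fin (a + b)} (hf : f ∈ goodFuns a b hadj) :
    funClique a b c f ∈ (cliques (encAdj a b c hadj σ)).filter Full := by
  rw [mem_goodFuns] at hf
  rw [Finset.mem_filter]
  refine ⟨?_, ?_⟩
  · simp only [cliques, Finset.mem_filter, Finset.mem_univ, true_and]
    intro u hu w hw huw
    rw [mem_funClique] at hu hw
    have hu' := congrArg Fin.val hu
    have hw' := congrArg Fin.val hw
    simp only [liftPos] at hu' hw'
    rw [encAdj_true_iff]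
    have hne : u.1 ≠ w.1 := by
      intro e; apply huw
      obtain ⟨p, i⟩ := u; obtain ⟨q, j⟩ := w
      simp only at e hu hw; subst e; rw [hu, hw]
    refine ⟨hne, ?_, fun hU hW => ?_⟩
    · rintro (⟨h, -, -⟩ | ⟨h, -, -⟩)
      · have := (f u.1).isLt; omega
      · have := (f w.1).isLt; omega
    · exact hf u.1 w.1 hne (by omega) (by omega)
  · intro p
    refine ⟨(p, liftPos a b c (f p)), (mem_funClique a b c f _).mpr rfl, rfl, ?_⟩
    intro h
    have := congrArg Fin.val h
    simp [liftPos] at this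
/-- `[folklore]` a clique meeting every part off the apex contains no dead copy (this is where the
fixed-point-free `σ` is used: the dead copy of part `v` misses the non-apex vertex chosen in part `σ v`). -/
lemma le_of_full {a b c : ℕ} {hadj : Fin k → Fin k → Bool} {σ : Fin k → Fin k}
    (hσ : ∀ v, σ v ≠ v) {S : Finset (Vx k (a + b + c))}
    (hc : IsClique (encAdj a b c hadj σ) S) (hF : Full S) {w : Vx k (a + b + c)} (hw : w ∈ S) :
    w.2.val ≤ a + b := by
  by_contra hlt
  rw [not_le] at hlt
  obtain ⟨u, hu, hu1, hu0⟩ := hF (σ w.1)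
  have hne : w ≠ u := by
    intro e
    exact hσ w.1 (by rw [← hu1, e])
  have h := hc w hw u hu hne
  rw [encAdj_true_iff] at h
  exact h.2.1 (Or.inl ⟨hlt, hu1, hu0⟩)
/-- **Full cliques = transversals of good position choices.** -/
theorem full_cliques_eq_image {a b c : ℕ} {hadj : Fin k → Fin k → Bool} {σ : Fin k → Fin k}
    (hσ : ∀ v, σ v ≠ v) :
    (cliques (encAdj a b c hadj σ)).filter Full
      = (goodFuns a b hadj).image (funClique a b c) := by
  ext S
  constructor
  · intro hS
    rw [Finset.mem_filter] at hS
    have hc : IsClique (encAdj a b c hadj σ) S := by simpa [cliques] using hS.1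
    have hF := hS.2
    have hna := (card_eq_of_full (encAdj_nopart (hadj := hadj) (σ := σ)) hc hF).2
    have hle : ∀ w ∈ S, w.2.val ≤ a + b := fun w hw => le_of_full hσ hc hF hw
    have hF' := hF
    choose g hgS hg1 hg0 using hF'
    have key : ∀ p, 1 ≤ (g p).2.val ∧ (g p).2.val ≤ a + b := by
      intro p
      refine ⟨?_, hle _ (hgS p)⟩
      have : (g p).2.val ≠ 0 := by
        intro h; apply hg0 p; exact Fin.ext (by simpa using h)
      omega
    refine Finset.mem_image.mpr ⟨fun p => ⟨(g p).2.val - 1, by have := key p; omega⟩, ?_, ?_⟩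
    · rw [mem_goodFuns]
      intro u v huv hu hv
      simp only at hu hv
      have hne : g u ≠ g v := by
        intro e; apply huv
        have := congrArg Prod.fst e
        rwa [hg1, hg1] at this
      have h := hc (g u) (hgS u) (g v) (hgS v) hne
      rw [encAdj_true_iff] at h
      have h' := h.2.2 ⟨by have := key u; omega, (key u).2⟩ ⟨by have := key v; omega, (key v).2⟩
      rwa [hg1, hg1] at h'
    · ext w
      rw [mem_funClique]
      constructor
      · intro hw
        have hval : (liftPos a b c (⟨(g w.1).2.val - 1, by have := key w.1; omega⟩ : Fin (a + b))).val
            = (g w.1).2.val := by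
          simp only [liftPos]; have := key w.1; omega
        have e : w = g w.1 := Prod.ext (hg1 w.1).symm (Fin.ext (by rw [hw, hval]))
        rw [e]; exact hgS _
      · intro hw
        have e : g w.1 = w := eq_of_same_part (encAdj_nopart (hadj := hadj) (σ := σ)) hc (hgS _) hw (hg1 _)
        apply Fin.ext
        simp only [liftPos]
        rw [← e]
        have := key w.1
        simp only [hg1]
        omega
  · intro hS
    obtain ⟨f, hf, rfl⟩ := Finset.mem_image.mp hS
    exact funClique_mem σ hf
/-! ## Counting good position choices fibrewise over their independent set -/
/-- `[folklore]` a position choice is good iff its H-positions form an independent set. -/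
lemma good_iff {a b : ℕ} {hadj : Fin k → Fin k → Bool} (f : Fin k → Fin (a + b)) :
    f ∈ goodFuns a b hadj ↔ hset a b f ∈ indepSets hadj := by
  rw [mem_goodFuns]
  simp only [hset, indepSets, Finset.mem_filter, Finset.mem_univ, true_and]
  exact ⟨fun h u hu v hv huv => h u v huv hu hv, fun h u v huv hu hv => h u hu v hv huv⟩
/-- `[folklore]` there are `b` H-positions. -/
lemma card_filter_ge (a b : ℕ) :
    ((univ : Finset (Fin (a + b))).filter (fun x => a ≤ x.val)).card = b := by
  rw [← Finset.card_image_of_injective _ Fin.val_injective]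
  have : ((univ : Finset (Fin (a + b))).filter (fun x => a ≤ x.val)).image Fin.val
      = Finset.Ico a (a + b) := by
    ext n
    simp only [Finset.mem_image, Finset.mem_filter, Finset.mem_univ, true_and, Finset.mem_Ico]
    constructor
    · rintro ⟨x, hx, rfl⟩; exact ⟨hx, x.isLt⟩
    · rintro ⟨h1, h2⟩; exact ⟨⟨n, h2⟩, h1, rfl⟩
  rw [this, Nat.card_Ico]; omega
/-- `[folklore]` there are `a` free positions. -/
lemma card_filter_lt (a b : ℕ) :
    ((univ : Finset (Fin (a + b))).filter (fun x => ¬ a ≤ x.val)).card = a := by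
  rw [← Finset.card_image_of_injective _ Fin.val_injective]
  have : ((univ : Finset (Fin (a + b))).filter (fun x => ¬ a ≤ x.val)).image Fin.val
      = Finset.range a := by
    ext n
    simp only [Finset.mem_image, Finset.mem_filter, Finset.mem_univ, true_and, Finset.mem_range]
    constructor
    · rintro ⟨x, hx, rfl⟩; omega
    · intro hn; exact ⟨⟨n, by omega⟩, by simp only; omega, rfl⟩
  rw [this, Finset.card_range]
/-- `[folklore]` the fibre over a vertex set `I` is a box: H-positions on `I`, free positions elsewhere. -/
lemma filter_hset_eq_piFinset (a b : ℕ) (I : Finset (Fin k)) :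
    (univ : Finset (Fin k → Fin (a + b))).filter (fun f => hset a b f = I)
      = Fintype.piFinset (fun v => if v ∈ I then univ.filter (fun x : Fin (a + b) => a ≤ x.val)
          else univ.filter (fun x : Fin (a + b) => ¬ a ≤ x.val)) := by
  ext f
  simp only [Finset.mem_filter, Finset.mem_univ, true_and, Fintype.mem_piFinset]
  constructor
  · intro h v
    by_cases hv : v ∈ I
    · rw [if_pos hv, Finset.mem_filter]
      refine ⟨Finset.mem_univ _, ?_⟩
      rw [← h] at hv
      simpa [hset] using hv
    · rw [if_neg hv, Finset.mem_filter]
      refine ⟨Finset.mem_univ _, ?_⟩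
      intro hle; apply hv; rw [← h]; simp [hset, hle]
  · intro h
    ext v
    simp only [hset, Finset.mem_filter, Finset.mem_univ, true_and]
    constructor
    · intro hle
      by_contra hv
      have := h v
      rw [if_neg hv, Finset.mem_filter] at this
      exact this.2 hle
    · intro hv
      have := h v
      rw [if_pos hv, Finset.mem_filter] at this
      exact this.2
/-- `[folklore]` the fibre over `I` has `a^{k-|I|} b^{|I|}` elements. -/
lemma card_filter_hset (a b : ℕ) (I : Finset (Fin k)) :
    ((univ : Finset (Fin k → Fin (a + b))).filter (fun f => hset a b f = I)).card
      = a ^ (k - I.card) * b ^ I.card := by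
  rw [filter_hset_eq_piFinset, Fintype.card_piFinset]
  have h1 : ∀ v : Fin k, (if v ∈ I then univ.filter (fun x : Fin (a + b) => a ≤ x.val)
      else univ.filter (fun x : Fin (a + b) => ¬ a ≤ x.val)).card = if v ∈ I then b else a := by
    intro v
    split_ifs
    · exact card_filter_ge a b
    · exact card_filter_lt a b
  rw [Finset.prod_congr rfl (fun v _ => h1 v)]
  rw [← Finset.prod_sdiff (Finset.subset_univ I)]
  have e1 : (∏ v ∈ univ \ I, (if v ∈ I then b else a)) = ∏ v ∈ univ \ I, a :=
    Finset.prod_congr rfl (fun v hv => if_neg (Finset.mem_sdiff.mp hv).2)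
  have e2 : (∏ v ∈ I, (if v ∈ I then b else a)) = ∏ v ∈ I, b :=
    Finset.prod_congr rfl (fun v hv => if_pos hv)
  rw [e1, e2, Finset.prod_const, Finset.prod_const, Finset.card_univ_sdiff, Fintype.card_fin]
/-- **The number of good position choices is the bivariate independence polynomial `P_H(a,b)`.** -/
theorem card_goodFuns (a b : ℕ) (hadj : Fin k → Fin k → Bool) :
    (goodFuns a b hadj).card = ∑ I ∈ indepSets hadj, a ^ (k - I.card) * b ^ I.card := by
  rw [Finset.card_eq_sum_card_fiberwise (f := hset a b) (s := goodFuns a b hadj)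
    (t := indepSets hadj) (fun f hf => (good_iff f).mp hf)]
  refine Finset.sum_congr rfl (fun I hI => ?_)
  have : (goodFuns a b hadj).filter (fun f => hset a b f = I)
      = univ.filter (fun f => hset a b f = I) := by
    ext f
    simp only [Finset.mem_filter, Finset.mem_univ, true_and]
    constructor
    · exact fun h => h.2
    · intro h
      refine ⟨(good_iff f).mpr ?_, h⟩
      rw [h]; exact hI
  rw [this, card_filter_hset]
/-! ## The identity -/
/-- **DEQ-A07F, Theorem W1 (combinatorial form, all parameters).**  For every graph `H` on `Fin k`
(symmetric Boolean adjacency), every `a b c : ℕ` and every fixed-point-free `σ`, the signed clique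
count of the encoding graph `K(a+b+c+1, k) − D(H; a, b, c)` equals
`(-1)^k · Σ_{I ∈ Ind(H)} a^{k-|I|} b^{|I|}` (`= (-1)^k a^k Z_H(b/a)`, the hard-core partition
function of `H` at activity `b/a`, for `a ≥ 1`). -/
theorem signed_clique_count_hardCore (a b c : ℕ) (hadj : Fin k → Fin k → Bool)
    (hsymm : ∀ p q, hadj p q = hadj q p) (σ : Fin k → Fin k) (hσ : ∀ v, σ v ≠ v) :
    (∑ S ∈ cliques (encAdj a b c hadj σ), (-1 : ℤ) ^ S.card)
      = (-1 : ℤ) ^ k * ((∑ I ∈ indepSets hadj, a ^ (k - I.card) * b ^ I.card : ℕ) : ℤ) := by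
  rw [signed_clique_count (encAdj_symm hsymm) encAdj_nopart (fun p q j hpq => encAdj_apex p q j hpq),
    full_cliques_eq_image hσ, Finset.card_image_of_injective _ (funClique_injective a b c),
    card_goodFuns]

/-- Corollary `a = 1` (encodings `(1, b, c)`, e.g. `(m; a, b, c) = (16; 1, 5, 9)` of DEQ-A07F Theorem
W2(ii)): the signed clique count is `(-1)^k ·` the independence polynomial of `H` at `b`. -/
theorem signed_clique_count_indepPoly (b c : ℕ) (hadj : Fin k → Fin k → Bool)
    (hsymm : ∀ p q, hadj p q = hadj q p) (σ : Fin k → Fin k) (hσ : ∀ v, σ v ≠ v) :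
    (∑ S ∈ cliques (encAdj 1 b c hadj σ), (-1 : ℤ) ^ S.card)
      = (-1 : ℤ) ^ k * ((∑ I ∈ indepSets hadj, b ^ I.card : ℕ) : ℤ) := by
  rw [signed_clique_count_hardCore 1 b c hadj hsymm σ hσ]
  simp

/-- Corollary `a = b = 1` (the `m = 3` encoding of DEQ-A07F §2, any number `c` of dead copies): the
signed clique count is `(-1)^k ·` the number of independent sets of `H`. -/
theorem signed_clique_count_indepSets (c : ℕ) (hadj : Fin k → Fin k → Bool)
    (hsymm : ∀ p q, hadj p q = hadj q p) (σ : Fin k → Fin k) (hσ : ∀ v, σ v ≠ v) :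
    (∑ S ∈ cliques (encAdj 1 1 c hadj σ), (-1 : ℤ) ^ S.card)
      = (-1 : ℤ) ^ k * ((indepSets hadj).card : ℤ) := by
  rw [signed_clique_count_hardCore 1 1 c hadj hsymm σ hσ]
  simp

/-! ## Sanity instances (kernel-evaluated) -/

/-- The path `P₃` on `Fin 3` (edges `0–1`, `1–2`). -/
def pathAdj3 (p q : Fin 3) : Bool := decide ((p.val + 1 = q.val) ∨ (q.val + 1 = p.val))

/-- The cyclic shift on `Fin 3` (fixed-point free). -/
def rot3 (v : Fin 3) : Fin 3 := v + 1

/-- `P₃` has independent sets `∅, {0}, {1}, {2}, {0,2}`; with `(a,b,c) = (2,1,0)` (`m = 4`):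
`P(2,1) = 2³ + 3·2² + 1·2 = 22`, so the signed clique count is `(-1)^3 · 22 = -22`. -/
example : (∑ S ∈ cliques (encAdj (k := 3) 2 1 0 pathAdj3 rot3), (-1 : ℤ) ^ S.card) = -22 := by
  rw [signed_clique_count_hardCore 2 1 0 pathAdj3 (by decide) rot3 (by decide)]
  decide

/-- Same `H = P₃` with `(a,b,c) = (1,2,1)` (`m = 5`, one dead copy per part):
`P(1,2) = 1 + 3·2 + 1·4 = 11`, signed clique count `-11`. -/
example : (∑ S ∈ cliques (encAdj (k := 3) 1 2 1 pathAdj3 rot3), (-1 : ℤ) ^ S.card) = -11 := by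
  rw [signed_clique_count_hardCore 1 2 1 pathAdj3 (by decide) rot3 (by decide)]
  decide

/-- A direct evaluation not passing through the theorem (checks the encoding itself on a tiny case):
`k = 2`, `H = K₂`, `(a,b,c) = (1,1,0)`: vertices `Fin 2 × Fin 3`, independent sets `∅, {0}, {1}`,
signed clique count `(+1) · 3 = 3`. -/
example : (∑ S ∈ cliques (encAdj (k := 2) 1 1 0 (fun p q => decide (p ≠ q)) (fun v => v + 1)),
    (-1 : ℤ) ^ S.card) = 3 := by
  decide

end Summit.QuantumAdvantage.Dequantization.ApexHardCore
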